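import Literature.AlgebraicGeometry.AbelianSchemes.AbelianSchemeQuotientPoincareIsotropyOfSubgroup
import Literature.AlgebraicGeometry.AbelianSchemes.WeilPairingLevelIsotropyOfIdealTorsionSections
import HarnessLib

/-!
# The `hiso₂` binder of the quotient-dual engine for the IDEAL-TORSION kernels `K ≤ A[𝔟](S)`, `K₂ ≤ A[𝔠](S)`, `𝔠·𝔟̄ = (n)`, from Rosati rows alone
# ([MumfordAV1970] §23 p. 208 and Thm. 2; [MumfordFogartyKirwan1994] Def. 6.2–6.3; [MilneAV2008] I §8–§9)

Layer `Literature/AlgebraicGeometry/AbelianSchemes`, namespace `Literature.AlgebraicGeometry.AbelianSchemes.AbelianSchemeOver`.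
THEOREMS ONLY (no definition, no named fact, no instance, no `sorry`).  Cell `hodgecm-mathlib` (D-0151), P6 «MOD programme», crux hLiu418
(`stmt-HodgeConjecture-24832`, `--supports`, count-neutral), line L3 ROOF road «DUAL-B̄» (LA3-plan RULINGS #2–#4): the H3 SOCKET of the
non-Lagrangian quotient-dual engine CLOSED for the kernel pair «`K := A[𝔟]`, `K₂ := A[n𝔟̄⁻¹]`» — ★ H3 `hiso_of_isLambdaOfAt_of_weilPairingLevel_eq_one_of_subgroup`
(p849018) composed with the ★ ISOTROPY organ `weilPairingLevel_eq_one_of_restrictPt_of_comp_i_eq_one` (p849216).  After this file the engine's `hiso₂`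
input carries NO Weil-pairing language: it is discharged by (i) a `Θ`-witness of `λ̄` at every geometric point (a polarisation, ★ `Polarization.exists_ample`),
(ii) the ROSATI ROWS `ι(j) ≫ λ = λ ≫ ι(b)^∨` pairing the nonzero `j ∈ 𝔟̄` with `b ∈ 𝔟` (for a CM action with `ι`-compatible `λ`: `j = b̄`), (iii) the
isogenies `ι(r)`, `r ≠ 0`, onto and dominant on geometric fibres, (iv) `𝔠·𝔟̄ = (n)` with `n` invertible at geometric points.  HC_CM is proved only
modulo the 2 remaining named inputs (hLiu418 24832, h413 24833) until rung 0 closes; nothing here is about HC.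

THE MATHEMATICS ([MumfordAV1970] §23 Thm. 2: a polarisation descends through an isogeny whose kernel is `e^λ`-isotropic; here the pair of kernels
`(A[𝔟], A[n𝔟̄⁻¹])` is `ē^Θ_n`-orthogonal by the Rosati adjunction `ē(ι(b)x, z) = ē(x, ι(b̄)z)` and `A[n𝔟̄⁻¹] = ι(b̄)·A[n]`, ★ p849147∕p849181∕p849216):
for the isogeny quotient `ψ : A → A/K`, `π : A/K → A` (`ψ ≫ π = [n]`), a dual pair `(Â, 𝒫)` of `A`, `λ : A → Â` with a `Θ`-witness at every
geometric point, an action `ι : 𝒪 → End_S(A)` of a Dedekind domain with the data (ii)–(iv), a finite `n`-torsion subgroup `K ≤ A(S)` killed by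
`ι(𝔟)` and an `n`-torsion subgroup `K₂ ≤ A(S)` killed by `ι(𝔠)`: for every `σ ∈ K₂` and every geometric point `s̄`,
**`(1_{A/K} × λσ(s̄))^*((π × 1_Â)^*𝒫) ≅ 𝒪`** — the `hiso₂` binder of ★ `map_le_poincareStabilizerSubgroup_of_subgroup` (H2, p849009), token for token.

* **`hiso_of_idealTorsion_of_rosati`** (THE HEAD).

## References
* [MumfordAV1970] D. Mumford, *Abelian Varieties* (1970), §15 Thm. 1 (p. 143), §23 p. 208 and Thm. 2 (p. 231).
* [MumfordFogartyKirwan1994] D. Mumford, J. Fogarty, F. Kirwan, *Geometric Invariant Theory*, Ch. 6 §2 Def. 6.2–6.3 (p. 120).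
* [MilneAV2008] J. S. Milne, *Abelian Varieties* (2008), I §8 pp. 36–37, I §9 Thm. 9.1 (p. 42).
-/

set_option autoImplicit false

noncomputable section

universe u

open CategoryTheory CategoryTheory.Limits AlgebraicGeometry MonoidalCategory CartesianMonoidalCategory
open scoped MonObj

namespace Literature.AlgebraicGeometry.AbelianSchemes.AbelianSchemeOver

open Literature.AlgebraicGeometry.Motives Literature.AlgebraicGeometry.AbelianVarieties Literature.AlgebraicGeometry.Modules

variable {S : Scheme.{u}} (A : AbelianSchemeOver S)
  {Y : Scheme.{u}} (u : S ⟶ Y) (K : Subgroup A.Sections) [IsCommMonObj A.X] {n : ℕ}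
  (hK : ∀ σ : K, (σ : A.Sections) ^ n = 1)
  [Finite K] [Y.IsSeparated] [IsSeparated (A.X.hom ≫ u)] [S.IsSeparated]
  (hcov : ∀ x : A.left, ∃ O : (A.translationActionOver u K).StableAffineOpens, x ∈ O.1)
  [LocallyOfFiniteType (A.X.hom ≫ u)] [IsLocallyNoetherian Y]
  (hG : ∃ _ : GrpObj (A.quotientOver u K), IsMonHom (A.quotientMk u K hcov))
  (hsm : Smooth (A.quotientOver u K).hom) (hgc : GeometricallyConnected (A.quotientOver u K).hom)
  (D : A.DualPair) [IsAffine Y]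
  (hfree : ∀ (Ω : Type u) [Field Ω] [IsAlgClosed Ω] (x : Spec (.of Ω) ⟶ A.left) (σ : K), σ ≠ 1 →
    x ≫ (A.translation (σ : A.Sections)).left ≠ x)

include hfree in
/-- **`hiso₂` FOR THE IDEAL-TORSION KERNEL PAIR `(A[𝔟], A[𝔠])`, `𝔠·𝔟̄ = (n)`, FROM ROSATI ROWS.**  For the isogeny quotient `ψ : A → A/K`, `π : A/K → A`
(`ψ ≫ π = [n]`, `A` of relative dimension `g`, `n` invertible at geometric points), a dual pair `(Â, 𝒫)`, `λ : A → Â` with a `Θ`-witness `λ̄ = Λ(𝒪(Θ))`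
at every geometric point (`hpol`, e.g. ★ `Polarization.exists_ample`), an action `ι : 𝒪 → End_S(A)` of a Dedekind domain whose isogenies `ι(r)`
(`r ≠ 0`) are onto on geometric fibre points (`hsurj`), ideals `𝔟`, `𝔟̄ ≠ 0`, `𝔠` with `𝔠·𝔟̄ = (n)` such that every nonzero `j ∈ 𝔟̄` has a Rosati
partner `b ∈ 𝔟` (`ι(j) ≫ λ = λ ≫ ι(b)^∨`, `ι(b)` dominant on geometric fibres — `hros`), the finite `n`-torsion subgroup `K ≤ A(S)` killed by `ι(𝔟)`
(`hK𝔟`) and an `n`-torsion subgroup `K₂ ≤ A(S)` killed by `ι(𝔠)` (`hK₂𝔠`): for every `σ ∈ K₂` and geometric point `s̄`,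
`(1_{A/K} × λσ(s̄))^*((π × 1_Â)^*𝒫) ≅ 𝒪` — the `hiso₂` binder of ★ `map_le_poincareStabilizerSubgroup_of_subgroup`.  (★ H3 + ★ isotropy organ.)
[cite: MumfordAV1970, §23 (p. 208) and Thm. 2 (p. 231)] [cite: MilneAV2008, I §9 Thm. 9.1 (p. 42)] [cite: MumfordFogartyKirwan1994, Ch. 6 §2 Definition 6.2–6.3 (p. 120)] -/
theorem hiso_of_idealTorsion_of_rosati (lam : A.X ⟶ D.hat.X) {g : ℕ} (hA : A.IsOfRelDim g)
    (hn : ∀ ⦃Ω : Type u⦄ [Field Ω] [IsAlgClosed Ω] (_ : Spec (.of Ω) ⟶ S), (n : Ω) ≠ 0)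
    (hpol : ∀ ⦃Ω : Type u⦄ [Field Ω] [IsAlgClosed Ω] (s : Spec (.of Ω) ⟶ S),
      ∃ Θ : CartierDivisor (A.fibre s).toAbelianVariety.X.left, A.IsLambdaOfAt s D lam Θ)
    {O : Type*} [CommRing O] [IsDedekindDomain O] (act : A.RingAction O)
    (hsurj : ∀ ⦃Ω : Type u⦄ [Field Ω] [IsAlgClosed Ω] (s : Spec (.of Ω) ⟶ S) (r : O), r ≠ 0 →
      haveI := act.isMonHom r
      Function.Surjective (fun x : (A.fibre s).toAbelianVariety.Points Ω => AlgPoints.map (fibreHom (act.i r) s).hom.hom.hom x))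
    {𝔟 𝔟' 𝔠 : Ideal O} (h𝔟'0 : 𝔟' ≠ ⊥) (h𝔠 : 𝔠 * 𝔟' = Ideal.span {(n : O)})
    (hros : ∀ ⦃Ω : Type u⦄ [Field Ω] [IsAlgClosed Ω] (s : Spec (.of Ω) ⟶ S), ∀ j ∈ 𝔟', j ≠ 0 → ∃ b ∈ 𝔟,
      (haveI := act.isMonHom b; IsDominant (AbelianVariety.Hom.toSchemeHom (fibreHom (act.i b) s))) ∧
      (haveI := act.isMonHom b; act.i j ≫ lam = lam ≫ DualPair.dualIsogenyOver (act.i b) D D))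
    (hK𝔟 : ∀ (κ : K), ∀ b ∈ 𝔟, (κ : A.Sections) ≫ act.i b = 1)
    (K₂ : Subgroup A.Sections) (hK₂ : ∀ σ : K₂, (σ : A.Sections) ^ n = 1) (hK₂𝔠 : ∀ (σ : K₂), ∀ r ∈ 𝔠, (σ : A.Sections) ≫ act.i r = 1) :
    ∀ (σ : K₂) ⦃Ω : Type u⦄ [Field Ω] [IsAlgClosed Ω] (s : Spec (.of Ω) ⟶ S),
      Nonempty ((Scheme.Modules.pullback ((A.quotientBy u K hcov hG hsm hgc).baseChangeToProd D.hat s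
          (D.hat.restrict s ((σ : A.Sections) ≫ lam)).left (Over.w _))).obj
        ((Scheme.Modules.pullback ((A.mulNDesc u K hK hcov : (A.quotientBy u K hcov hG hsm hgc).X ⟶ A.X) ▷ D.hat.X).left).obj
          D.P) ≅ SheafOfModules.unit _) := by
  refine A.hiso_of_isLambdaOfAt_of_weilPairingLevel_eq_one_of_subgroup u K hK hcov hG hsm hgc D hfree lam hA hn K₂ hK₂
    fun σ Ω _ _ s => ?_
  obtain ⟨Θ, hΘ⟩ := hpol s
  refine ⟨Θ, hΘ, fun κ x y hx hy => ?_⟩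
  exact weilPairingLevel_eq_one_of_restrictPt_of_comp_i_eq_one act s
    (fun r x => haveI := act.isMonHom r; AlgPoints.map (fibreHom (act.i r) s).hom.hom.hom x) (fun _ _ => rfl) D lam
    (hsurj s) h𝔟'0 h𝔠 (hros s) hΘ (κ : A.Sections) (σ : A.Sections) (hK𝔟 κ) (hK₂𝔠 σ) x y hx hy

end Literature.AlgebraicGeometry.AbelianSchemes.AbelianSchemeOver

end
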